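/-
Copyright (c) 2026 the pub-hodgecm-mathlib formalisation cell (harness21).  Prover seat hodgecm-mathlib-K2Liu-p11 (g0), Track B «K2-LIT»,
#184♮ = hLiu418 = `stmt-HodgeConjecture-24832`; LEAD F0P6-plan (g13) RULING «M-157o» S5-W1-arch → K2Liu-p11 (g0).
File S5-W1-arch: the archimedean rank-one Whittaker functional of the Gaussian LINE at the centre — continued value, and its VANISHING for
the wrong sign of `h`.  THEOREMS ONLY.
-/
import Summits.HodgeConjecture.HodgeConjecture.Theorems.K2E1ArchWhittakerContinuation   -- ★ Track A: Hecke–Bump engine (`…_mul_phase_eq_mellin`, entire Mellin)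
import Summits.HodgeConjecture.HodgeConjecture.Theorems.K2LiuArchInducedTubeSection      -- ★ (this seat): `archScalarSection`, `denom_J_mul_transl_one`
import Mathlib.Analysis.SpecialFunctions.JapaneseBracket                                 -- `integrable_rpow_neg_one_add_norm_sq`
import HarnessLib

/-!
# Crux `HLiu418`, S5-W1-arch: the rank-one archimedean Whittaker functional of the Gaussian line at the centre `s = 0`

Cell `hodgecm-mathlib`, crux item hLiu418 = `stmt-HodgeConjecture-24832` (helper lane `--supports`, count-neutral).

At a complex place `σ` of `L` over a real place of `L⁺`, the rank-one group is `U(1,1)(ℝ)` (tube frame `l = Fin 1`), the Hermitian LINE is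
`V_σ = (ℂ, a|z|²)`, `a = ±1`, and the Siegel–Weil section of its Gaussian is the scalar-type vector `f⁰_{s,a}` (★ `archScalarSection a s`,
by ★ `eq_mul_archScalarSection`).  Its Whittaker functional is `W_h(s) = ∫_ℝ f⁰_{s,a}(J·n(b)) e^{−2πihb} db`; for `a = 1`,
`f⁰_{s,1}(J·n(b)) = (b+i)^{−1}(1+b²)^{−s} = (b − i)(1+b²)^{−(s+1)}` (§3), so with the ★ Track-A engine (Hecke's Gamma trick + Gaussian fibre)
`W_h(s) = E_h(s) := Γ(s+1)⁻¹·√π·(−iπh·𝓜[K_h](s−½) − i·𝓜[K_h](s+½))`, `K_h(t) = e^{−t−π²h²/t}`, on `re s > ½` (§2 integration by parts for the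
first moment, §3), where `E_h` is ENTIRE (★ `differentiable_mellin_expKernel`, `1/Γ` entire).  AT THE CENTRE (§4):
`E_h(0) = −i√π·𝓜[K_h](½)·(h/|h| + 1)` (§1: `𝓜[K_A](−w) = A^{−w}𝓜[K_A](w)`), hence
* `archLineWhittaker_centre_eq_zero_of_neg : h < 0 → E_h(0) = 0` — the WRONG SIGN for `a = +1` (the orbit `{|z|² = h}` is empty);
* `archLineWhittaker_centre_of_pos : 0 < h → E_h(0) = −2i√π·𝓜[K_h](½)` (the orbital integral of the Gaussian over `{|z|² = h}`);
and `a = −1` is the mirror image (`b ↦ −b`, `h ↦ −h`; not typed here — one `integral_comp_neg` away).  No Bessel function is evaluated.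
References: [Bump1997, §1.6], [KudlaRallis1994 (citation only)], [corpus:paper-arxiv-1409.0767 p.12 Prop. 4.1] (mechanism) — derived here.
HONEST LABEL: HC_CM is proved only modulo the 7 printed citations (2 remaining named inputs: hLiu418 = stmt-HodgeConjecture-24832,
h413 = stmt-HodgeConjecture-24833) until rung 0 closes; count-neutral helper, closes no socket.
-/

set_option autoImplicit false
set_option linter.dupNamespace false

noncomputable section

open Complex MeasureTheory Set Filter
open scoped ComplexOrder Topology

namespace Summit.HodgeConjecture.HodgeConjecture.Cruxes.HLiu418.K2LiuRankOneArchWhittakerCentre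

open Summit.HodgeConjecture.HodgeConjecture.Cruxes.H413.K2E1ArchWhittakerContinuation

/-! ## §1  The kernel's Mellin symmetry `𝓜[K_A](−w) = A^{−w}·𝓜[K_A](w)` -/

/-- **`𝓜[e^{−t−A/t}](−w) = A^{−w}·𝓜[e^{−t−A/t}](w)`** for `A > 0` (the substitution `t ↦ A/t`; Mathlib `mellin_comp_inv`,
`mellin_comp_mul_left`). [Bump1997, §1.6] -/
theorem mellin_expKernel_neg {A : ℝ} (hA : 0 < A) (w : ℂ) :
    mellin (fun t : ℝ => Complex.exp (-(t : ℂ) - (A : ℂ) / (t : ℂ))) (-w) =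
      (A : ℂ) ^ (-w) * mellin (fun t : ℝ => Complex.exp (-(t : ℂ) - (A : ℂ) / (t : ℂ))) w := by
  have hA0 : (A : ℂ) ≠ 0 := by exact_mod_cast hA.ne'
  have h1 : (fun t : ℝ => (fun u : ℝ => Complex.exp (-(u : ℂ) - (A : ℂ) / (u : ℂ))) t⁻¹) =
      fun t : ℝ => (fun u : ℝ => Complex.exp (-(u : ℂ) - (A : ℂ) / (u : ℂ))) (A * t) := by
    funext t
    simp only
    congr 1
    by_cases ht : t = 0
    · subst ht
      simp
    · have ht0 : (t : ℂ) ≠ 0 := by exact_mod_cast ht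
      push_cast
      field_simp
      ring
  have h2 := mellin_comp_mul_left (fun u : ℝ => Complex.exp (-(u : ℂ) - (A : ℂ) / (u : ℂ))) w hA
  rw [← mellin_comp_inv, h1]
  simp only at h2 ⊢
  rw [h2, smul_eq_mul]

/-! ## §2  Integration by parts for the first moment -/

/-- `b ↦ ((1+b²) : ℂ)^{−s}` has derivative `−s·(1+b²)^{−s−1}·2b`. [folklore] -/
theorem hasDerivAt_onePlusSq_cpow (s : ℂ) (b : ℝ) :
    HasDerivAt (fun b : ℝ => (((1 + b ^ 2 : ℝ)) : ℂ) ^ (-s)) (-s * (((1 + b ^ 2 : ℝ)) : ℂ) ^ (-s - 1) * (2 * b)) b := by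
  have hg : HasDerivAt (fun b : ℝ => (((1 + b ^ 2 : ℝ)) : ℂ)) ((2 * b : ℝ) : ℂ) b := by
    refine HasDerivAt.ofReal_comp ?_
    have h := ((hasDerivAt_id b).pow 2).const_add 1
    simpa using h
  have hslit : (((1 + b ^ 2 : ℝ)) : ℂ) ∈ slitPlane := Complex.ofReal_mem_slitPlane.2 (by positivity)
  have hp : HasDerivAt (fun z : ℂ => z ^ (-s)) (-s * (((1 + b ^ 2 : ℝ)) : ℂ) ^ (-s - 1)) (((1 + b ^ 2 : ℝ)) : ℂ) :=
    (Complex.hasStrictDerivAt_cpow_const hslit).hasDerivAt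
  have h := hp.comp b hg
  have hfun : ((fun z : ℂ => z ^ (-s)) ∘ fun b : ℝ => (((1 + b ^ 2 : ℝ)) : ℂ)) = fun b : ℝ => (((1 + b ^ 2 : ℝ)) : ℂ) ^ (-s) := by
    funext b
    rfl
  rw [hfun] at h
  refine h.congr_deriv ?_
  push_cast
  ring

/-- `b ↦ e^{−2πihb}` has derivative `−2πih·e^{−2πihb}`. [folklore] -/
theorem hasDerivAt_phase (h b : ℝ) :
    HasDerivAt (fun b : ℝ => Complex.exp (-(2 * Real.pi * Complex.I * h * b))) (-(2 * Real.pi * Complex.I * h) * Complex.exp (-(2 * Real.pi * Complex.I * h * b))) b := by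
  have hlin : HasDerivAt (fun y : ℝ => (-(2 * Real.pi * Complex.I * h)) * (y : ℂ)) (-(2 * Real.pi * Complex.I * h) * 1) b := by
    have h0 : HasDerivAt (fun y : ℝ => (y : ℂ)) 1 b := by
      simpa using (hasDerivAt_id b).ofReal_comp
    exact h0.const_mul _
  have hfun : (fun b : ℝ => Complex.exp (-(2 * Real.pi * Complex.I * h * b))) =
      fun y : ℝ => Complex.exp ((-(2 * Real.pi * Complex.I * h)) * (y : ℂ)) := by
    funext y
    ring_nf
  rw [hfun]
  have h2 := hlin.cexp
  convert h2 using 1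
  rw [show (-(2 * Real.pi * Complex.I * h)) * (b : ℂ) = -(2 * Real.pi * Complex.I * h * b) by ring]
  ring

/-- Norm of the symbol: `‖(1+b²)^{−s}‖ = (1+b²)^{−re s}`. [folklore] -/
theorem norm_onePlusSq_cpow (s : ℂ) (b : ℝ) : ‖(((1 + b ^ 2 : ℝ)) : ℂ) ^ (-s)‖ = (1 + b ^ 2) ^ (-s.re) := by
  rw [Complex.norm_cpow_eq_rpow_re_of_pos (by positivity)]
  simp

-- `‖e^{−2πihb}‖ = 1` is ★ `Literature.Analysis.FluidPDE.ShearCascade.norm_exp_phase` in print-form; used inline below (`Complex.norm_exp`).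

/-- `b ↦ (1+b²)^{−σ}` is integrable on `ℝ` for `σ > ½` (Japanese bracket). [folklore] -/
theorem integrable_onePlusSq_rpow {σ : ℝ} (hσ : 1 / 2 < σ) : Integrable fun b : ℝ => (1 + b ^ 2) ^ (-σ) := by
  have h := integrable_rpow_neg_one_add_norm_sq (E := ℝ) (μ := volume) (r := 2 * σ) (by simp; linarith)
  refine h.congr (Filter.Eventually.of_forall fun b => ?_)
  simp only [Real.norm_eq_abs, sq_abs]
  congr 1
  ring

/-- The symbol times the phase is integrable for `re s > ½`. [folklore] -/
theorem integrable_symbol_mul_phase {s : ℂ} (hs : 1 / 2 < s.re) (h : ℝ) :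
    Integrable fun b : ℝ => (((1 + b ^ 2 : ℝ)) : ℂ) ^ (-s) * Complex.exp (-(2 * Real.pi * Complex.I * h * b)) := by
  refine Integrable.mono' (integrable_onePlusSq_rpow hs) ?_ (Filter.Eventually.of_forall fun b => ?_)
  · refine Continuous.aestronglyMeasurable ?_
    refine Continuous.mul ?_ (by fun_prop)
    exact (Complex.continuous_ofReal.comp (by fun_prop)).cpow continuous_const fun b => Complex.ofReal_mem_slitPlane.2 (by positivity)
  · have hph : ‖Complex.exp (-(2 * Real.pi * Complex.I * h * b))‖ = 1 := by
      rw [Complex.norm_exp]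
      simp
    rw [norm_mul, norm_onePlusSq_cpow, hph, mul_one]

/-- The first-moment symbol times the phase is integrable for `re s > ½`: `2|b|(1+b²)^{−re s−1} ≤ (1+b²)^{−re s}`. [folklore] -/
theorem integrable_moment_mul_phase {s : ℂ} (hs : 1 / 2 < s.re) (h : ℝ) :
    Integrable fun b : ℝ => -s * (((1 + b ^ 2 : ℝ)) : ℂ) ^ (-s - 1) * (2 * b) * Complex.exp (-(2 * Real.pi * Complex.I * h * b)) := by
  refine Integrable.mono' ((integrable_onePlusSq_rpow hs).const_mul ‖s‖) ?_ (Filter.Eventually.of_forall fun b => ?_)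
  · refine Continuous.aestronglyMeasurable ?_
    refine Continuous.mul (Continuous.mul (Continuous.mul continuous_const ?_) (by fun_prop)) (by fun_prop)
    exact (Complex.continuous_ofReal.comp (by fun_prop)).cpow continuous_const fun b => Complex.ofReal_mem_slitPlane.2 (by positivity)
  · have hph : ‖Complex.exp (-(2 * Real.pi * Complex.I * h * b))‖ = 1 := by
      rw [Complex.norm_exp]
      simp
    rw [norm_mul, norm_mul, norm_mul, hph, mul_one, norm_neg, show (-s - 1 : ℂ) = -(s + 1) by ring, norm_onePlusSq_cpow]
    have hb : ‖(2 * b : ℂ)‖ = 2 * |b| := by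
      rw [show (2 * b : ℂ) = ((2 * b : ℝ) : ℂ) by push_cast; ring, Complex.norm_real, Real.norm_eq_abs, abs_mul, abs_two]
    rw [hb, Complex.add_re, Complex.one_re]
    have h1 : 0 < 1 + b ^ 2 := by positivity
    have hkey : 2 * |b| ≤ 1 + b ^ 2 := by nlinarith [sq_abs b, sq_nonneg (|b| - 1), abs_nonneg b]
    have hpow : (1 + b ^ 2) ^ (-(s.re + 1)) * (2 * |b|) ≤ (1 + b ^ 2) ^ (-s.re) := by
      have e : (1 + b ^ 2) ^ (-s.re) = (1 + b ^ 2) ^ (-(s.re + 1)) * (1 + b ^ 2) := by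
        conv_rhs => rw [show (1 + b ^ 2 : ℝ) ^ (-(s.re + 1)) * (1 + b ^ 2) = (1 + b ^ 2) ^ (-(s.re + 1)) * (1 + b ^ 2) ^ (1 : ℝ) by
          rw [Real.rpow_one], ← Real.rpow_add h1]
        congr 1
        ring
      rw [e]
      exact mul_le_mul_of_nonneg_left hkey (Real.rpow_nonneg h1.le _)
    calc ‖s‖ * (1 + b ^ 2) ^ (-(s.re + 1)) * (2 * |b|) = ‖s‖ * ((1 + b ^ 2) ^ (-(s.re + 1)) * (2 * |b|)) := by ring
      _ ≤ ‖s‖ * (1 + b ^ 2) ^ (-s.re) := mul_le_mul_of_nonneg_left hpow (norm_nonneg _)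

/-- **INTEGRATION BY PARTS FOR THE FIRST MOMENT** (`re s > ½`, `s ≠ 0` automatic):
`∫_ℝ b(1+b²)^{−(s+1)} e^{−2πihb} db = (−iπh/s)·∫_ℝ (1+b²)^{−s} e^{−2πihb} db`. [Bump1997, §1.6] -/
theorem integral_moment_eq {s : ℂ} (hs : 1 / 2 < s.re) (h : ℝ) :
    ∫ b : ℝ, (b : ℂ) * (((1 + b ^ 2 : ℝ)) : ℂ) ^ (-s - 1) * Complex.exp (-(2 * Real.pi * Complex.I * h * b)) =
      (-(Real.pi * Complex.I * h) / s) * ∫ b : ℝ, (((1 + b ^ 2 : ℝ)) : ℂ) ^ (-s) * Complex.exp (-(2 * Real.pi * Complex.I * h * b)) := by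
  have hs0 : s ≠ 0 := by
    intro h0
    rw [h0, Complex.zero_re] at hs
    linarith
  have hIBP := integral_mul_deriv_eq_deriv_mul_of_integrable
    (u := fun b : ℝ => (((1 + b ^ 2 : ℝ)) : ℂ) ^ (-s))
    (u' := fun b : ℝ => -s * (((1 + b ^ 2 : ℝ)) : ℂ) ^ (-s - 1) * (2 * b))
    (v := fun b : ℝ => Complex.exp (-(2 * Real.pi * Complex.I * h * b)))
    (v' := fun b : ℝ => -(2 * Real.pi * Complex.I * h) * Complex.exp (-(2 * Real.pi * Complex.I * h * b)))
    (fun b _ => hasDerivAt_onePlusSq_cpow s b) (fun b _ => hasDerivAt_phase h b) ?_ ?_ ?_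
  rotate_left
  · -- `u * v'` integrable
    have hi := (integrable_symbol_mul_phase hs h).const_mul (-(2 * Real.pi * Complex.I * h))
    refine hi.congr (Filter.Eventually.of_forall fun b => ?_)
    simp only [Pi.mul_apply]
    ring
  · -- `u' * v` integrable
    exact (integrable_moment_mul_phase hs h).congr (Filter.Eventually.of_forall fun b => by simp only [Pi.mul_apply])
  · exact (integrable_symbol_mul_phase hs h).congr (Filter.Eventually.of_forall fun b => by simp only [Pi.mul_apply])
  -- read off
  have hL : ∫ b : ℝ, (((1 + b ^ 2 : ℝ)) : ℂ) ^ (-s) * (-(2 * Real.pi * Complex.I * h) * Complex.exp (-(2 * Real.pi * Complex.I * h * b))) =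
      -(2 * Real.pi * Complex.I * h) * ∫ b : ℝ, (((1 + b ^ 2 : ℝ)) : ℂ) ^ (-s) * Complex.exp (-(2 * Real.pi * Complex.I * h * b)) := by
    rw [← integral_const_mul]
    refine integral_congr_ae (Filter.Eventually.of_forall fun b => ?_)
    simp only
    ring
  have hR : ∫ b : ℝ, -s * (((1 + b ^ 2 : ℝ)) : ℂ) ^ (-s - 1) * (2 * b) * Complex.exp (-(2 * Real.pi * Complex.I * h * b)) =
      (-2 * s) * ∫ b : ℝ, (b : ℂ) * (((1 + b ^ 2 : ℝ)) : ℂ) ^ (-s - 1) * Complex.exp (-(2 * Real.pi * Complex.I * h * b)) := by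
    rw [← integral_const_mul]
    refine integral_congr_ae (Filter.Eventually.of_forall fun b => ?_)
    simp only
    ring
  rw [hL, hR] at hIBP
  have h2s : (-2 : ℂ) * s ≠ 0 := mul_ne_zero (by norm_num) hs0
  have key : (-2 * s) * ∫ b : ℝ, (b : ℂ) * (((1 + b ^ 2 : ℝ)) : ℂ) ^ (-s - 1) * Complex.exp (-(2 * Real.pi * Complex.I * h * b)) =
      (2 * Real.pi * Complex.I * h) * ∫ b : ℝ, (((1 + b ^ 2 : ℝ)) : ℂ) ^ (-s) * Complex.exp (-(2 * Real.pi * Complex.I * h * b)) := by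
    linear_combination hIBP
  apply mul_left_cancel₀ h2s
  rw [key]
  field_simp

/-! ## §3  The Whittaker integral of `f⁰_{s,1}` on `U(1,1)` and its entire closed form -/

open Literature.NumberTheory.ModularForms.SiegelUpperHalfSpace (denom)
open Summit.HodgeConjecture.HodgeConjecture.Cruxes.HLiu418.K2LiuArchInducedTubeDefs
open Summit.HodgeConjecture.HodgeConjecture.Cruxes.HLiu418.K2LiuArchInducedTubeSection
open Matrix in
/-- **THE SECTION ON THE BIG CELL (`l = Fin 1`)**: `f⁰_{s,k}(J·n(β)) = (β+i)^{−k}·|β+i|^{k−2s−1}` (★ `denom_J_mul_transl_one`). -/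
theorem archScalarSection_J_transl_fin_one (k : ℤ) (s : ℂ) (β : ℝ) :
    archScalarSection k s (Matrix.J (Fin 1) ℂ * fromBlocks 1 ((β : ℂ) • (1 : Matrix (Fin 1) (Fin 1) ℂ)) 0 1) =
      ((β : ℂ) + I) ^ (-k) * (((‖(β : ℂ) + I‖ : ℝ) : ℂ) ^ ((k : ℂ) - 2 * s - 1)) := by
  have hden : denom (Matrix.J (Fin 1) ℂ * fromBlocks 1 ((β : ℂ) • (1 : Matrix (Fin 1) (Fin 1) ℂ)) 0 1) (I • 1) =
      ((β : ℂ) + I) • (1 : Matrix (Fin 1) (Fin 1) ℂ) := by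
    have h := denom_J_mul_transl_one (l := Fin 1) ((β : ℂ) • (1 : Matrix (Fin 1) (Fin 1) ℂ))
    rw [Matrix.mul_one] at h
    rw [h, add_smul]
  rw [archScalarSection_apply, hden, Matrix.det_smul, Matrix.det_one, mul_one, Fintype.card_fin, pow_one, Nat.cast_one]

/-- `|β + i|² = 1 + β²`, so `|β+i|^{−2s} = (1+β²)^{−s}` (principal powers of positive reals). [folklore] -/
theorem norm_add_I_cpow (β : ℝ) (s : ℂ) : ((‖(β : ℂ) + I‖ : ℝ) : ℂ) ^ (-(2 * s)) = (((1 + β ^ 2 : ℝ)) : ℂ) ^ (-s) := by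
  have hn : ‖(β : ℂ) + I‖ ^ 2 = 1 + β ^ 2 := by
    rw [Complex.sq_norm, show ((β : ℂ) + I) = (β : ℂ) + (1 : ℝ) * I by simp, Complex.normSq_add_mul_I]
    ring
  have hpos : 0 < ‖(β : ℂ) + I‖ := by
    have : 0 < ‖(β : ℂ) + I‖ ^ 2 := by rw [hn]; positivity
    nlinarith [norm_nonneg ((β : ℂ) + I)]
  have hx0 : (((‖(β : ℂ) + I‖ : ℝ)) : ℂ) ≠ 0 := by exact_mod_cast hpos.ne'
  have hy0 : (((1 + β ^ 2 : ℝ)) : ℂ) ≠ 0 := by exact_mod_cast (show (1 + β ^ 2 : ℝ) ≠ 0 by positivity)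
  rw [Complex.cpow_def_of_ne_zero hx0, Complex.cpow_def_of_ne_zero hy0, ← Complex.ofReal_log hpos.le,
    ← Complex.ofReal_log (by positivity), ← hn, Real.log_pow]
  push_cast
  ring

/-- `(β + i)^{−1} = (β − i)·(1+β²)^{−1}`. [folklore] -/
theorem inv_add_I (β : ℝ) : ((β : ℂ) + I)⁻¹ = ((β : ℂ) - I) * ((((1 + β ^ 2 : ℝ)) : ℂ))⁻¹ := by
  have h0 : (((1 + β ^ 2 : ℝ)) : ℂ) ≠ 0 := by exact_mod_cast (show (1 + β ^ 2 : ℝ) ≠ 0 by positivity)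
  have h1 : ((β : ℂ) + I) * ((β : ℂ) - I) = (((1 + β ^ 2 : ℝ)) : ℂ) := by
    push_cast
    linear_combination (-1 : ℂ) * I_mul_I
  have hz : ((β : ℂ) + I) ≠ 0 := by
    intro h
    have := congrArg Complex.im h
    simp at this
  rw [eq_mul_inv_iff_mul_eq₀ h0, inv_mul_eq_iff_eq_mul₀ hz, h1]

/-- **THE INTEGRAND**: `f⁰_{s,1}(J·n(β))·e^{−2πihβ} = (β − i)(1+β²)^{−(s+1)}e^{−2πihβ}` = first moment − `i`·symbol at `s+1`. -/
theorem integrand_fin_one (s : ℂ) (h β : ℝ) :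
    archScalarSection 1 s (Matrix.J (Fin 1) ℂ * Matrix.fromBlocks 1 ((β : ℂ) • (1 : Matrix (Fin 1) (Fin 1) ℂ)) 0 1) *
        Complex.exp (-(2 * Real.pi * Complex.I * h * β)) =
      (β : ℂ) * (((1 + β ^ 2 : ℝ)) : ℂ) ^ (-(s + 1) - 1 + 1) * Complex.exp (-(2 * Real.pi * Complex.I * h * β)) * 0 +
      ((β : ℂ) * (((1 + β ^ 2 : ℝ)) : ℂ) ^ (-s - 1) * Complex.exp (-(2 * Real.pi * Complex.I * h * β)) -
        I * ((((1 + β ^ 2 : ℝ)) : ℂ) ^ (-(s + 1)) * Complex.exp (-(2 * Real.pi * Complex.I * h * β)))) := by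
  have h0 : (((1 + β ^ 2 : ℝ)) : ℂ) ≠ 0 := by exact_mod_cast (show (1 + β ^ 2 : ℝ) ≠ 0 by positivity)
  rw [archScalarSection_J_transl_fin_one, Int.cast_one, show ((1 : ℂ) - 2 * s - 1) = -(2 * s) by ring, norm_add_I_cpow, zpow_neg, zpow_one,
    inv_add_I, mul_zero, zero_add]
  have hpow : ((((1 + β ^ 2 : ℝ)) : ℂ))⁻¹ * (((1 + β ^ 2 : ℝ)) : ℂ) ^ (-s) = (((1 + β ^ 2 : ℝ)) : ℂ) ^ (-s - 1) := by
    rw [sub_eq_add_neg, Complex.cpow_add _ _ h0, Complex.cpow_neg_one, mul_comm]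
  rw [show (-(s + 1) : ℂ) = -s - 1 by ring, ← hpow]
  ring

/-- **`W_h(s) = E_h(s)` ON `re s > ½`**: the Whittaker integral of the scalar-type section `f⁰_{s,1}` of `U(1,1)` equals the closed form
`E_h(s) = Γ(s+1)⁻¹·√π·(−iπh·𝓜[K_h](s−½) − i·𝓜[K_h](s+½))`, `K_h(t) = e^{−t−π²h²/t}` (★ Track-A engine at `z = s`, `s+1` + §2). [Bump1997, §1.6] -/
theorem archLineWhittaker_eq {s : ℂ} (hs : 1 / 2 < s.re) (h : ℝ) :
    ∫ β : ℝ, archScalarSection 1 s (Matrix.J (Fin 1) ℂ * Matrix.fromBlocks 1 ((β : ℂ) • (1 : Matrix (Fin 1) (Fin 1) ℂ)) 0 1) *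
        Complex.exp (-(2 * Real.pi * Complex.I * h * β)) =
      (Complex.Gamma (s + 1))⁻¹ * ((Real.sqrt Real.pi : ℝ) : ℂ) *
        (-(Real.pi * Complex.I * h) * mellin (fun t : ℝ => Complex.exp (-(t : ℂ) - ((Real.pi ^ 2 * h ^ 2 : ℝ) : ℂ) / (t : ℂ))) (s - 1 / 2) -
          I * mellin (fun t : ℝ => Complex.exp (-(t : ℂ) - ((Real.pi ^ 2 * h ^ 2 : ℝ) : ℂ) / (t : ℂ))) (s + 1 / 2)) := by
  have hs0 : s ≠ 0 := by
    intro h0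
    rw [h0, Complex.zero_re] at hs
    linarith
  have hs1 : 1 / 2 < (s + 1).re := by
    rw [Complex.add_re, Complex.one_re]
    linarith
  -- split the integrand
  simp only [integrand_fin_one, mul_zero, zero_add]
  have hI1 : Integrable fun β : ℝ => (β : ℂ) * (((1 + β ^ 2 : ℝ)) : ℂ) ^ (-s - 1) * Complex.exp (-(2 * Real.pi * Complex.I * h * β)) := by
    have hi := (integrable_moment_mul_phase hs h).const_mul ((-2 * s)⁻¹)
    refine hi.congr (Filter.Eventually.of_forall fun β => ?_)
    have h2s : (-2 : ℂ) * s ≠ 0 := mul_ne_zero (by norm_num) hs0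
    field_simp
  have hI2 : Integrable fun β : ℝ => I * ((((1 + β ^ 2 : ℝ)) : ℂ) ^ (-(s + 1)) * Complex.exp (-(2 * Real.pi * Complex.I * h * β))) :=
    (integrable_symbol_mul_phase hs1 h).const_mul I
  rw [integral_sub hI1 hI2, integral_const_mul, integral_moment_eq hs h]
  -- the two symbol integrals by the Track-A engine (`c = 1`)
  have hE0 := integral_onePlusSqPow_mul_phase_eq_mellin hs one_pos h
  have hE1 := integral_onePlusSqPow_mul_phase_eq_mellin hs1 one_pos h
  simp only [one_mul, div_one] at hE0 hE1
  rw [hE0, hE1, show (s + 1 - 1 / 2 : ℂ) = s + 1 / 2 by ring]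
  -- `Γ(s+1) = s Γ(s)`
  have hΓ : Complex.Gamma (s + 1) = s * Complex.Gamma s := Complex.Gamma_add_one s hs0
  have hΓ0 : Complex.Gamma s ≠ 0 := Complex.Gamma_ne_zero_of_re_pos (by linarith)
  have hΓ1 : Complex.Gamma (s + 1) ≠ 0 := by
    rw [hΓ]
    exact mul_ne_zero hs0 hΓ0
  rw [hΓ]
  field_simp

/-- **THE CLOSED FORM IS ENTIRE** (`h ≠ 0`): `1/Γ(s+1)` and both Mellin transforms are entire (★ `differentiable_mellin_expKernel`). -/
theorem differentiable_archLineWhittakerClosedForm {h : ℝ} (hh : h ≠ 0) :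
    Differentiable ℂ fun s : ℂ => (Complex.Gamma (s + 1))⁻¹ * ((Real.sqrt Real.pi : ℝ) : ℂ) *
      (-(Real.pi * Complex.I * h) * mellin (fun t : ℝ => Complex.exp (-(t : ℂ) - ((Real.pi ^ 2 * h ^ 2 : ℝ) : ℂ) / (t : ℂ))) (s - 1 / 2) -
        I * mellin (fun t : ℝ => Complex.exp (-(t : ℂ) - ((Real.pi ^ 2 * h ^ 2 : ℝ) : ℂ) / (t : ℂ))) (s + 1 / 2)) := by
  have hA : 0 < Real.pi ^ 2 * h ^ 2 := by positivity
  have hM := differentiable_mellin_expKernel hA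
  have hG : Differentiable ℂ fun s : ℂ => (Complex.Gamma (s + 1))⁻¹ :=
    Complex.differentiable_one_div_Gamma.comp (differentiable_id.add_const 1)
  exact (hG.mul (differentiable_const _)).mul
    (((differentiable_const _).mul (hM.comp (differentiable_id.sub_const _))).sub
      ((differentiable_const _).mul (hM.comp (differentiable_id.add_const _))))

/-! ## §4  The centre `s = 0` -/

/-- `(π²h²)^{−1/2} = (π|h|)⁻¹` (principal power of a positive real). [folklore] -/
theorem sq_cpow_neg_half {h : ℝ} (hh : h ≠ 0) :
    (((Real.pi ^ 2 * h ^ 2 : ℝ)) : ℂ) ^ (-(1 / 2 : ℂ)) = (((Real.pi * |h|)⁻¹ : ℝ) : ℂ) := by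
  have hx : 0 < Real.pi * |h| := mul_pos Real.pi_pos (abs_pos.2 hh)
  have hsq : (Real.pi ^ 2 * h ^ 2 : ℝ) = (Real.pi * |h|) ^ (2 : ℝ) := by
    rw [Real.rpow_two, mul_pow, sq_abs]
  rw [hsq, show (-(1 / 2 : ℂ)) = ((-(1 / 2) : ℝ) : ℂ) by push_cast; ring, ← Complex.ofReal_cpow (by positivity),
    ← Real.rpow_mul hx.le, show (2 : ℝ) * -(1 / 2) = -1 by norm_num, Real.rpow_neg_one]

/-- **THE VALUE AT THE CENTRE**: `E_h(0) = −i√π·𝓜[K_h](½)·(h/|h| + 1)` (`h ≠ 0`; §1 at `w = ½`, `Γ(1) = 1`). [Bump1997, §1.6] -/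
theorem archLineWhittakerClosedForm_zero {h : ℝ} (hh : h ≠ 0) :
    (Complex.Gamma ((0 : ℂ) + 1))⁻¹ * ((Real.sqrt Real.pi : ℝ) : ℂ) *
        (-(Real.pi * Complex.I * h) * mellin (fun t : ℝ => Complex.exp (-(t : ℂ) - ((Real.pi ^ 2 * h ^ 2 : ℝ) : ℂ) / (t : ℂ))) ((0 : ℂ) - 1 / 2) -
          I * mellin (fun t : ℝ => Complex.exp (-(t : ℂ) - ((Real.pi ^ 2 * h ^ 2 : ℝ) : ℂ) / (t : ℂ))) ((0 : ℂ) + 1 / 2)) =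
      -I * ((Real.sqrt Real.pi : ℝ) : ℂ) * mellin (fun t : ℝ => Complex.exp (-(t : ℂ) - ((Real.pi ^ 2 * h ^ 2 : ℝ) : ℂ) / (t : ℂ))) (1 / 2) *
        (((h / |h| : ℝ) : ℂ) + 1) := by
  have hA : 0 < Real.pi ^ 2 * h ^ 2 := by positivity
  have hπ : (Real.pi : ℂ) ≠ 0 := by exact_mod_cast Real.pi_ne_zero
  have habs : ((|h| : ℝ) : ℂ) ≠ 0 := by exact_mod_cast (abs_pos.2 hh).ne'
  rw [zero_add, Complex.Gamma_one, inv_one, one_mul, zero_sub, mellin_expKernel_neg hA (1 / 2), sq_cpow_neg_half hh]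
  push_cast
  field_simp
  ring

/-- **WRONG SIGN ⇒ THE CENTRAL WHITTAKER VALUE VANISHES** (`a = +1`, `h < 0`: the orbit `{|z|² = h}` is empty): `E_h(0) = 0`.
[corpus:paper-arxiv-1409.0767 p.12 Prop. 4.1] (mechanism), derived. -/
theorem archLineWhittaker_centre_eq_zero_of_neg {h : ℝ} (hh : h < 0) :
    (Complex.Gamma ((0 : ℂ) + 1))⁻¹ * ((Real.sqrt Real.pi : ℝ) : ℂ) *
        (-(Real.pi * Complex.I * h) * mellin (fun t : ℝ => Complex.exp (-(t : ℂ) - ((Real.pi ^ 2 * h ^ 2 : ℝ) : ℂ) / (t : ℂ))) ((0 : ℂ) - 1 / 2) -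
          I * mellin (fun t : ℝ => Complex.exp (-(t : ℂ) - ((Real.pi ^ 2 * h ^ 2 : ℝ) : ℂ) / (t : ℂ))) ((0 : ℂ) + 1 / 2)) = 0 := by
  rw [archLineWhittakerClosedForm_zero hh.ne, abs_of_neg hh, div_neg, div_self hh.ne]
  push_cast
  ring

/-- **REPRESENTED SIGN** (`a = +1`, `h > 0`): `E_h(0) = −2i√π·𝓜[K_h](½)` (the Gaussian's orbital integral over `{|z|² = h}`, up to the
frame constant). -/
theorem archLineWhittaker_centre_of_pos {h : ℝ} (hh : 0 < h) :
    (Complex.Gamma ((0 : ℂ) + 1))⁻¹ * ((Real.sqrt Real.pi : ℝ) : ℂ) *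
        (-(Real.pi * Complex.I * h) * mellin (fun t : ℝ => Complex.exp (-(t : ℂ) - ((Real.pi ^ 2 * h ^ 2 : ℝ) : ℂ) / (t : ℂ))) ((0 : ℂ) - 1 / 2) -
          I * mellin (fun t : ℝ => Complex.exp (-(t : ℂ) - ((Real.pi ^ 2 * h ^ 2 : ℝ) : ℂ) / (t : ℂ))) ((0 : ℂ) + 1 / 2)) =
      -2 * I * ((Real.sqrt Real.pi : ℝ) : ℂ) * mellin (fun t : ℝ => Complex.exp (-(t : ℂ) - ((Real.pi ^ 2 * h ^ 2 : ℝ) : ℂ) / (t : ℂ))) (1 / 2) := by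
  rw [archLineWhittakerClosedForm_zero hh.ne', abs_of_pos hh, div_self hh.ne']
  push_cast
  ring

end Summit.HodgeConjecture.HodgeConjecture.Cruxes.HLiu418.K2LiuRankOneArchWhittakerCentre

end
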